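import Summits.CriticalPhenomena.Ising3D.TaylorRegionDeltaAffine
import Summits.CriticalPhenomena.Ising3D.TaylorRegionSplitOdd
import Mathlib.Tactic.Linarith
import Mathlib.Tactic.Positivity
import Mathlib.Tactic.Ring
import HarnessLib

/-!
# The odd cone over a WIDE box: δ-expanded row triples combined AFTER bounding, landed `(E, θ)` tail (item (L4), part 2;
HOME/pub-ising3x-recog-1/gen12/REGION-ON-MARGIN-FUNCTIONAL.md §5–§6)
(cell `pub-ising3x`, seat recog-1 gen 12; gate (g2))

HONEST FRAMING: lottery ticket; floor = tightest certified 3D Ising CFT bounds; no exact-solution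
claim without a proof. Island framing: certified exclusion region at stated derivative order and
assumptions; not a determination of the 3D Ising critical exponents beyond that.

`OddConeRegionDataΔ` (box, functional, `Ψ`, `κ₀`, root atoms, parameters; `toCertH` = the landed `OddConeRegionCertH`, used for
the atom checks, the sizes and the TAIL), the five δ-row triples per `j` (`q̂₃` about the mean `b₀ ± Wb`, `q̂₄, q̂₅` about
`σ₀ ± Wσ`, `ψ̂₀` exact, `ψ̂_t` about `t₀ ± Wt`), `rowLitOK` (containment in producer literals), `pieceM` / `pieceR` / `pieceOK`
(the affine tests of `TaylorRegionDeltaAffine` with the box scalars `K₁, K₂, K₃`), `sizesOK`, and **`oddCone_of_splitΔ`** ⇒ the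
`odd_cone` field shape (`OddConeAt` for every point of the box, every `E ≥ E₀`, every integer `j ≤ E`). Elementary. [folklore]
-/

namespace Summit.CriticalPhenomena.Ising3D

open Finset Set
open Literature.Analysis.ValidatedNumerics Literature.Analysis.ValidatedNumerics.PolyMP
open Literature.Analysis.ValidatedNumerics.NumericsMP (MI)
open Literature.MathematicalPhysics.QuantumFieldTheory.ConformalBootstrap3D

/-! ### Data and Booleans -/

/-- Five literal triples per row: `(L3, L4, L5, Lψ0, Lψt)`. [folklore] -/
abbrev OddLit := ITriple × ITriple × ITriple × ITriple × ITriple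

/-- Data of a wide-box odd-cone certificate (`ccQ` rows — keep `0`; `ccT` tail). [folklore] -/
structure OddConeRegionDataΔ where
  S : ℕ
  σlo : ℚ
  σhi : ℚ
  εlo : ℚ
  εhi : ℚ
  l : List (ℕ × ℕ)
  cQ : Fin 5 → ℕ × ℕ → ℚ
  lψ : List (ℕ × ℕ)
  ψQ : ℕ × ℕ → ℚ
  κ₀Q : ℚ
  k1lo : RootAtom
  k1hi : RootAtom
  k2lo : RootAtom
  k2hi : RootAtom
  k3lo : RootAtom
  k3hi : RootAtom
  E0 : ℚ
  E1 : ℚ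
  J1 : ℕ
  ccQ : ℚ
  ccT : ℚ
  N : ℕ
  R : ℕ
  prmM1 : HSParams
  prmM2 : HSParams
  prmR1 : HSParams
  prmR2 : HSParams
  dPj : ℕ

namespace OddConeRegionDataΔ

variable (d : OddConeRegionDataΔ)

/-- [folklore] -/
def σ0 : ℚ := (d.σlo + d.σhi) / 2
/-- [folklore] -/
def Wσ : ℚ := (d.σhi - d.σlo) / 2
/-- [folklore] -/
def ε0 : ℚ := (d.εlo + d.εhi) / 2
/-- [folklore] -/
def Wε : ℚ := (d.εhi - d.εlo) / 2
/-- [folklore] -/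
def b0 : ℚ := (d.σ0 + d.ε0) / 2
/-- [folklore] -/
def Wb : ℚ := (d.Wσ + d.Wε) / 2
/-- [folklore] -/
def t0 : ℚ := d.σ0 - d.ε0
/-- [folklore] -/
def Wt : ℚ := d.Wσ + d.Wε

/-- The landed certificate data (atoms, sizes, tail). [folklore] -/
def toCertH : OddConeRegionCertH where
  S := d.S
  box := ⟨d.σlo, d.σhi, d.εlo, d.εhi⟩
  l := d.l
  cQ := d.cQ
  lψ := d.lψ
  ψQ := d.ψQ
  κ₀Q := d.κ₀Q
  k1lo := d.k1lo
  k1hi := d.k1hi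
  k2lo := d.k2lo
  k2hi := d.k2hi
  k3lo := d.k3lo
  k3hi := d.k3hi
  E0 := d.E0
  E1 := d.E1
  J1 := d.J1
  ccQ := d.ccT
  N := d.N
  R := d.R
  prmM1 := d.prmM1
  prmM2 := d.prmM2
  prmR1 := d.prmR1
  prmR2 := d.prmR2
  dPj := d.dPj

/-- box scalars -/
def K1 : MI := MI.span d.k1hi.R d.k1lo.R
/-- [folklore] -/
def K2 : MI := MI.span d.k2hi.R d.k2lo.R
/-- [folklore] -/
def K3 : MI := MI.span d.k3lo.R d.k3hi.R

/-- a δ-row triple of a component -/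
def trip (c : ℕ × ℕ → ℚ) (σQ s₀ W : ℚ) (lst : List (ℕ × ℕ)) (j : ℕ) : ITriple :=
  (qRowOfTableI (deltaT0 d.S c σQ s₀ d.ccQ lst) d.N j, qRowOfTableI (deltaT1 d.S c σQ s₀ d.ccQ lst) d.N j,
    qRowOfTableI (deltaT2 d.S c σQ s₀ W d.ccQ lst) d.N j)
/-- [folklore] -/
def T3 (j : ℕ) : ITriple := d.trip (d.cQ 2) (-1) d.b0 d.Wb d.l j
/-- [folklore] -/
def T4 (j : ℕ) : ITriple := d.trip (d.cQ 3) (-1) d.σ0 d.Wσ d.l j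
/-- [folklore] -/
def T5 (j : ℕ) : ITriple := d.trip (d.cQ 4) 1 d.σ0 d.Wσ d.l j
/-- [folklore] -/
def Tψ0 (j : ℕ) : ITriple := d.trip d.ψQ 0 0 0 d.lψ j
/-- [folklore] -/
def Tψt (j : ℕ) : ITriple := d.trip d.ψQ 0 d.t0 d.Wt d.lψ j

/-- [folklore] -/
def noLit5 : OddLit := (([], [], []), ([], [], []), ([], [], []), ([], [], []), ([], [], []))

/-- Containment of the five computed triples of row `j` in the literals. [folklore] -/
def rowLitOK (L : List OddLit) (j : ℕ) : Bool :=
  subset3 (d.T3 j) (L.getD j noLit5).1 && subset3 (d.T4 j) (L.getD j noLit5).2.1 &&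
    subset3 (d.T5 j) (L.getD j noLit5).2.2.1 && subset3 (d.Tψ0 j) (L.getD j noLit5).2.2.2.1 &&
    subset3 (d.Tψt j) (L.getD j noLit5).2.2.2.2

/-- [folklore] -/
def pieceLo (K j k : ℕ) : ℚ := (max d.E0 (j : ℚ) - d.ccQ) + (k : ℚ) * ((d.E1 - max d.E0 (j : ℚ)) / (K : ℚ))

/-- `M(ε) > 0` on the piece: `ψ̂₀`-enclosure plus `(−ε K₁) × q̂₃`-enclosure. [folklore] -/
def pieceM (Lj : OddLit) (ε : ℤ) (lo hi : ℚ) : Bool :=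
  decide (0 < lowB3 d.S Lj.2.2.2.1 lo hi 0 * (d.S : ℚ) +
    mulLo (MI.mulInt d.K1 (-ε)) (lowB3 d.S Lj.1 lo hi d.Wb) (hiB3 d.S Lj.1 lo hi d.Wb))

/-- `R(ε) > 0` on the piece. [folklore] -/
def pieceR (Lj : OddLit) (ε : ℤ) (lo hi : ℚ) : Bool :=
  decide (0 < lowB3 d.S Lj.2.1 lo hi d.Wσ * (d.S : ℚ) - hiB3 d.S Lj.2.2.1 lo hi d.Wσ * (d.S : ℚ) +
    mulLo (smulRatMI d.K2 (-(ε : ℚ) * (d.κ₀Q / 2))) (lowB3 d.S Lj.1 lo hi d.Wb) (hiB3 d.S Lj.1 lo hi d.Wb) +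
    mulLo (smulRatMI d.K3 (-(d.κ₀Q⁻¹ / 2))) (lowB3 d.S Lj.2.2.2.2 lo hi d.Wt) (hiB3 d.S Lj.2.2.2.2 lo hi d.Wt))

/-- ONE piece of row `j`. [folklore] -/
def pieceOK (L : List OddLit) (K j k : ℕ) : Bool :=
  decide (d.E1 < max d.E0 (j : ℚ)) ||
  (d.pieceM (L.getD j noLit5) 1 (d.pieceLo K j k) (d.pieceLo K j (k + 1)) &&
    d.pieceM (L.getD j noLit5) (-1) (d.pieceLo K j k) (d.pieceLo K j (k + 1)) &&
    d.pieceR (L.getD j noLit5) 1 (d.pieceLo K j k) (d.pieceLo K j (k + 1)) &&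
    d.pieceR (L.getD j noLit5) (-1) (d.pieceLo K j k) (d.pieceLo K j (k + 1)))

/-- Sizes: the landed sizes, a well-formed box, the five δ-table sizes. [folklore] -/
def sizesOK : Bool :=
  d.toCertH.data.sizesOK && decide (d.σlo ≤ d.σhi) && decide (d.εlo ≤ d.εhi) &&
  deltaSizeOK d.S (d.cQ 2) (-1) d.b0 d.Wb d.ccQ d.l d.N && deltaSizeOK d.S (d.cQ 3) (-1) d.σ0 d.Wσ d.ccQ d.l d.N &&
  deltaSizeOK d.S (d.cQ 4) 1 d.σ0 d.Wσ d.ccQ d.l d.N && deltaSizeOK d.S d.ψQ 0 0 0 d.ccQ d.lψ d.N &&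
  deltaSizeOK d.S d.ψQ 0 d.t0 d.Wt d.ccQ d.lψ d.N

end OddConeRegionDataΔ

/-- **The odd cone over a wide box** (the `odd_cone` field shape, `E_T = E₀`, `κ₀ = κ₀Q`). [folklore] -/
theorem oddCone_of_splitΔ (d : OddConeRegionDataΔ) (L : List OddLit) {K : ℕ} (hK : 0 < K) (hl : d.l.Nodup)
    (hlψ : d.lψ.Nodup) (ha : d.toCertH.atomsOK = true) (hs : d.sizesOK = true)
    (ht : d.toCertH.data.tail.check = true) (hr : ∀ j : ℕ, j < d.J1 + 1 → d.rowLitOK L j = true)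
    (hpc : ∀ j k : ℕ, j < d.J1 + 1 → k < K → d.pieceOK L K j k = true) :
    ∀ p ∈ Icc (d.σlo : ℝ) d.σhi ×ˢ Icc (d.εlo : ℝ) d.εhi, ∀ (E : ℝ) (j : ℕ), ((d.E0 : ℚ) : ℝ) ≤ E → (j : ℝ) ≤ E →
      OddConeAt (taylorCrossing (1 / 2) (1 / 2) d.l.toFinset fun i ab => (d.cQ i ab : ℝ))
        (∑ ab ∈ d.lψ.toFinset, (d.ψQ ab : ℝ) • taylorCoeffAt (1 / 2) (1 / 2) ab) (d.κ₀Q : ℝ) p.1 p.2 E j := by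
  simp only [OddConeRegionDataΔ.sizesOK, OddConeRegionDataH.sizesOK, Bool.and_eq_true, decide_eq_true_eq] at hs
  obtain ⟨⟨⟨⟨⟨⟨⟨hsz, hσ⟩, hε⟩, hZ3⟩, hZ4⟩, hZ5⟩, hZψ0⟩, hZψt⟩ := hs
  obtain ⟨⟨⟨⟨⟨⟨⟨⟨hS, hκ₀⟩, hE0⟩, hJ1⟩, _⟩, _⟩, _⟩, _⟩, _⟩ := hsz
  have hS : 0 < d.S := hS
  have hκ₀ : 0 < d.κ₀Q := hκ₀
  have hE0 : 0 < d.E0 := hE0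
  have hJ1 : d.E1 ≤ (d.J1 : ℚ) + 1 := hJ1
  simp only [OddConeRegionCertH.atomsOK, Bool.and_eq_true, decide_eq_true_eq] at ha
  obtain ⟨⟨⟨⟨⟨⟨⟨⟨_, _⟩, _⟩, hk1lo⟩, hk1hi⟩, hk2lo⟩, hk2hi⟩, hk3lo⟩, hk3hi⟩ := ha
  have hk1lo : d.k1lo.ok d.S 1 2 (d.σlo + d.εlo) = true := hk1lo
  have hk1hi : d.k1hi.ok d.S 1 2 (d.σhi + d.εhi) = true := hk1hi
  have hk2lo : d.k2lo.ok d.S 1 2 (d.εlo - d.σhi) = true := hk2lo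
  have hk2hi : d.k2hi.ok d.S 1 2 (d.εhi - d.σlo) = true := hk2hi
  have hk3lo : d.k3lo.ok d.S 2 1 (2 * d.εlo) = true := hk3lo
  have hk3hi : d.k3hi.ok d.S 2 1 (2 * d.εhi) = true := hk3hi
  have hWσ : 0 ≤ d.Wσ := by unfold OddConeRegionDataΔ.Wσ; linarith
  have hWε : 0 ≤ d.Wε := by unfold OddConeRegionDataΔ.Wε; linarith
  have hWb : 0 ≤ d.Wb := by unfold OddConeRegionDataΔ.Wb; linarith
  have hWt : 0 ≤ d.Wt := by unfold OddConeRegionDataΔ.Wt; linarith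
  intro p hp E j hE hj
  obtain ⟨h1, h2, h3, h4⟩ : (d.σlo : ℝ) ≤ p.1 ∧ p.1 ≤ d.σhi ∧ (d.εlo : ℝ) ≤ p.2 ∧ p.2 ≤ d.εhi := by
    simp only [Set.mem_prod, Set.mem_Icc] at hp; exact ⟨hp.1.1, hp.1.2, hp.2.1, hp.2.2⟩
  -- the six memberships (box scalars via root atoms), stated on the landed data of `toCertH`
  have hK1 : MI.mem d.S ((1 / 2 : ℝ) ^ (p.1 + p.2)) d.K1 :=
    mem_half_rpow_span hS hk1lo hk1hi (by push_cast; linarith) (by push_cast; linarith)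
  have hK2 : MI.mem d.S ((1 / 2 : ℝ) ^ (p.2 - p.1)) d.K2 :=
    mem_half_rpow_span hS hk2lo hk2hi (by push_cast; linarith) (by push_cast; linarith)
  have hK3 : MI.mem d.S ((1 / 2 : ℝ) ^ (-(2 * p.2))) d.K3 :=
    mem_half_rpow_neg_span hS hk3lo hk3hi (y := 2 * p.2) (by push_cast; linarith) (by push_cast; linarith)
  by_cases hE1 : ((d.E1 : ℚ) : ℝ) ≤ E
  · -- TAIL: the landed exact (E, θ) check on the box-enclosure data
    have hQ : ∀ q ∈ Icc (d.σlo : ℝ) d.σhi ×ˢ Icc (d.εlo : ℝ) d.εhi,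
        MI.mem d.S q.1 (enclQ d.S d.σlo d.σhi) ∧
        MI.mem d.S ((q.1 + q.2) / 2) (enclQ d.S ((d.σlo + d.εlo) / 2) ((d.σhi + d.εhi) / 2)) ∧
        MI.mem d.S (q.1 - q.2) (enclQ d.S (d.σlo - d.εhi) (d.σhi - d.εlo)) ∧ MI.mem d.S ((1 / 2 : ℝ) ^ (q.1 + q.2)) d.K1 ∧
        MI.mem d.S ((1 / 2 : ℝ) ^ (q.2 - q.1)) d.K2 ∧ MI.mem d.S ((1 / 2 : ℝ) ^ (-(2 * q.2))) d.K3 := by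
      intro q hq
      obtain ⟨g1, g2, g3, g4⟩ : (d.σlo : ℝ) ≤ q.1 ∧ q.1 ≤ d.σhi ∧ (d.εlo : ℝ) ≤ q.2 ∧ q.2 ≤ d.εhi := by
        simp only [Set.mem_prod, Set.mem_Icc] at hq; exact ⟨hq.1.1, hq.1.2, hq.2.1, hq.2.2⟩
      refine ⟨mem_enclQ _ g1 g2, mem_enclQ _ (by push_cast; linarith) (by push_cast; linarith),
        mem_enclQ _ (by push_cast; linarith) (by push_cast; linarith), ?_, ?_, ?_⟩
      · exact mem_half_rpow_span hS hk1lo hk1hi (by push_cast; linarith) (by push_cast; linarith)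
      · exact mem_half_rpow_span hS hk2lo hk2hi (by push_cast; linarith) (by push_cast; linarith)
      · exact mem_half_rpow_neg_span hS hk3lo hk3hi (y := 2 * q.2) (by push_cast; linarith) (by push_cast; linarith)
    have htl := oddCone_of_oddConeRegionCheckEJ d.toCertH.data.tail hl hlψ _ hQ ht p hp E j
    simp only [OddConeRegionDataH.tail, sub_add_cancel] at htl
    exact htl hE1 hj
  · -- BOUNDED PART
    have hElt : E < d.E1 := lt_of_not_ge hE1
    have hjJ : j < d.J1 + 1 := by
      have h1' : (j : ℝ) < (d.J1 : ℝ) + 1 := by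
        have : ((d.E1 : ℚ) : ℝ) ≤ (d.J1 : ℝ) + 1 := by exact_mod_cast hJ1
        linarith
      exact_mod_cast h1'
    -- the δ's
    have hδσ : |p.1 - d.σ0| ≤ d.Wσ := by
      unfold OddConeRegionDataΔ.σ0 OddConeRegionDataΔ.Wσ; push_cast; rw [abs_le]; constructor <;> linarith
    have hδb : |(p.1 + p.2) / 2 - d.b0| ≤ d.Wb := by
      unfold OddConeRegionDataΔ.b0 OddConeRegionDataΔ.Wb OddConeRegionDataΔ.σ0 OddConeRegionDataΔ.Wσ
        OddConeRegionDataΔ.ε0 OddConeRegionDataΔ.Wε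
      push_cast; rw [abs_le]; constructor <;> linarith
    have hδt : |(p.1 - p.2) - d.t0| ≤ d.Wt := by
      unfold OddConeRegionDataΔ.t0 OddConeRegionDataΔ.Wt OddConeRegionDataΔ.σ0 OddConeRegionDataΔ.Wσ
        OddConeRegionDataΔ.ε0 OddConeRegionDataΔ.Wε
      push_cast; rw [abs_le]; constructor <;> linarith
    have hδ0 : |(0 : ℝ)| ≤ ((0 : ℚ) : ℝ) := by simp
    -- q-sums as triples
    have e3 := qSum_eq_delta_rows hS (d.cQ 2) (-1) d.b0 hWb d.ccQ hl hZ3 hδb E j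
    have e4 := qSum_eq_delta_rows hS (d.cQ 3) (-1) d.σ0 hWσ d.ccQ hl hZ4 hδσ E j
    have e5 := qSum_eq_delta_rows hS (d.cQ 4) 1 d.σ0 hWσ d.ccQ hl hZ5 hδσ E j
    have eψ0 := qSum_eq_delta_rows hS d.ψQ 0 0 le_rfl d.ccQ hlψ hZψ0 hδ0 E j
    have eψt := qSum_eq_delta_rows hS d.ψQ 0 d.t0 hWt d.ccQ hlψ hZψt hδt E j
    have ab : ((d.b0 : ℚ) : ℝ) + ((p.1 + p.2) / 2 - d.b0) = (p.1 + p.2) / 2 := by ring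
    have aσ : ((d.σ0 : ℚ) : ℝ) + (p.1 - d.σ0) = p.1 := by ring
    have a0 : (((0 : ℚ) : ℚ) : ℝ) + (0 : ℝ) = 0 := by simp
    have at' : ((d.t0 : ℚ) : ℝ) + ((p.1 - p.2) - d.t0) = p.1 - p.2 := by ring
    rw [ab] at e3; rw [aσ] at e4 e5; rw [a0] at eψ0; rw [at'] at eψt
    simp only [Rat.cast_neg, Rat.cast_one, Rat.cast_zero] at e3 e4 e5 eψ0 eψt
    -- memberships in the computed triples, then in the literals
    have q3 := pmem3_delta_rows hS (d.cQ 2) (-1) d.b0 hWb d.ccQ d.l d.N j hδb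
    have q4 := pmem3_delta_rows hS (d.cQ 3) (-1) d.σ0 hWσ d.ccQ d.l d.N j hδσ
    have q5 := pmem3_delta_rows hS (d.cQ 4) 1 d.σ0 hWσ d.ccQ d.l d.N j hδσ
    have qψ0 := pmem3_delta_rows hS d.ψQ 0 0 le_rfl d.ccQ d.lψ d.N j hδ0
    have qψt := pmem3_delta_rows hS d.ψQ 0 d.t0 hWt d.ccQ d.lψ d.N j hδt
    have hrow := hr j hjJ
    simp only [OddConeRegionDataΔ.rowLitOK, Bool.and_eq_true] at hrow
    obtain ⟨⟨⟨⟨s3, s4⟩, s5⟩, sψ0⟩, sψt⟩ := hrow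
    have m3 := pmem3_of_subset3 q3 s3
    have m4 := pmem3_of_subset3 q4 s4
    have m5 := pmem3_of_subset3 q5 s5
    have mψ0 := pmem3_of_subset3 qψ0 sψ0
    have mψt := pmem3_of_subset3 qψt sψt
    -- locate the piece
    have hmE2 : max (d.E0 : ℝ) (j : ℝ) ≤ E := max_le hE hj
    have hmE : ((max d.E0 (j : ℚ) : ℚ) : ℝ) ≤ E := by push_cast; exact hmE2
    have hm1 : max d.E0 (j : ℚ) ≤ d.E1 := by
      have : ((max d.E0 (j : ℚ) : ℚ) : ℝ) ≤ ((d.E1 : ℚ) : ℝ) := hmE.trans hElt.le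
      exact_mod_cast this
    have hw : 0 ≤ (d.E1 - max d.E0 (j : ℚ)) / (K : ℚ) := div_nonneg (by linarith) (by positivity)
    have hmono : ∀ k : ℕ, d.pieceLo K j k ≤ d.pieceLo K j (k + 1) := fun k => by
      unfold OddConeRegionDataΔ.pieceLo; push_cast; nlinarith
    have e0 : d.pieceLo K j 0 = max d.E0 (j : ℚ) - d.ccQ := by unfold OddConeRegionDataΔ.pieceLo; simp
    have hKq : (K : ℚ) ≠ 0 := by exact_mod_cast hK.ne'
    have eK : d.pieceLo K j K = d.E1 - d.ccQ := by
      unfold OddConeRegionDataΔ.pieceLo; field_simp; ring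
    have hn1 : K - 1 + 1 = K := Nat.sub_add_cancel hK
    obtain ⟨k, hk, hk1, hk2⟩ := exists_mem_gridCell (fun k : ℕ => ((d.pieceLo K j k : ℚ) : ℝ)) (K - 1)
      (Δ := E - d.ccQ) (by show ((d.pieceLo K j 0 : ℚ) : ℝ) ≤ E - d.ccQ; rw [e0]; push_cast; linarith [hmE2])
      (by show E - d.ccQ ≤ ((d.pieceLo K j (K - 1 + 1) : ℚ) : ℝ); rw [hn1, eK]; push_cast; linarith)
    have hkK : k < K := by omega
    have hpiece := hpc j k hjJ hkK
    simp only [OddConeRegionDataΔ.pieceOK, OddConeRegionDataΔ.pieceM, OddConeRegionDataΔ.pieceR, Bool.or_eq_true,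
      Bool.and_eq_true, decide_eq_true_eq] at hpiece
    rcases hpiece with hvac | ⟨⟨⟨rM1, rM2⟩, rR1⟩, rR2⟩
    · exfalso
      have : ((d.E1 : ℚ) : ℝ) < ((max d.E0 (j : ℚ) : ℚ) : ℝ) := by exact_mod_cast hvac
      linarith
    -- enclosures of the five terms on this piece
    have L3 := lowB3_le' hS hWb m3 hk1 hk2 hδb
    have H3 := le_hiB3 hS hWb m3 hk1 hk2 hδb
    have L4 := lowB3_le' hS hWσ m4 hk1 hk2 hδσ
    have H5 := le_hiB3 hS hWσ m5 hk1 hk2 hδσ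
    have L0 := lowB3_le' hS le_rfl mψ0 hk1 hk2 hδ0
    have Lt := lowB3_le' hS hWt mψt hk1 hk2 hδt
    have Ht := le_hiB3 hS hWt mψt hk1 hk2 hδt
    -- scalar memberships
    have cM : ∀ ε : ℤ, MI.mem d.S ((1 / 2 : ℝ) ^ (p.1 + p.2) * ((-ε : ℤ) : ℝ)) (MI.mulInt d.K1 (-ε)) :=
      fun ε => MI.mem_mulInt hK1 (-ε)
    have cR3 : ∀ ε : ℤ, MI.mem d.S ((1 / 2 : ℝ) ^ (p.2 - p.1) * ((-(ε : ℚ) * (d.κ₀Q / 2) : ℚ) : ℝ))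
        (smulRatMI d.K2 (-(ε : ℚ) * (d.κ₀Q / 2))) := fun ε => mem_smulRatMI hK2 _
    have cRt : MI.mem d.S ((1 / 2 : ℝ) ^ (-(2 * p.2)) * ((-(d.κ₀Q⁻¹ / 2) : ℚ) : ℝ)) (smulRatMI d.K3 (-(d.κ₀Q⁻¹ / 2))) :=
      mem_smulRatMI hK3 _
    have vM1 := affine2_pos hS L0 L3 H3 (cM 1) rM1
    have vM2 := affine2_pos hS L0 L3 H3 (cM (-1)) rM2
    have vR1 := affine4_pos hS L4 H5 L3 H3 Lt Ht (cR3 1) cRt rR1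
    have vR2 := affine4_pos hS L4 H5 L3 H3 Lt Ht (cR3 (-1)) cRt rR2
    -- back to q-sums
    simp only [val3] at vM1 vM2 vR1 vR2
    rw [← e3, ← eψ0] at vM1 vM2
    rw [← e3, ← e4, ← e5, ← eψt] at vR1 vR2
    push_cast at vM1 vM2 vR1 vR2
    have hκ₁ : 0 ≤ (1 / 2 : ℝ) ^ (p.1 + p.2) := (Real.rpow_pos_of_pos (by norm_num) _).le
    have hκ₂ : 0 ≤ (1 / 2 : ℝ) ^ (p.2 - p.1) := (Real.rpow_pos_of_pos (by norm_num) _).le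
    have hκ₀R : (0 : ℝ) < (d.κ₀Q : ℝ) := by exact_mod_cast hκ₀
    refine oddConeAt_half_of_qCone _ _ _ _ _ p.1 p.2 E j hj ?_ ?_
    · rw [← abs_of_nonneg hκ₁, ← abs_mul, abs_le]
      constructor <;> linarith
    · have hc : 0 ≤ (d.κ₀Q : ℝ) / 2 * (1 / 2 : ℝ) ^ (p.2 - p.1) := by positivity
      rcases le_total 0 (qSum (fun ab => (d.cQ 2 ab : ℝ)) d.l.toFinset ((p.1 + p.2) / 2) (-1) E j) with h3 | h3
      · rw [abs_of_nonneg h3]; linarith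
      · rw [abs_of_nonpos h3]
        have := mul_nonneg hc (neg_nonneg.mpr h3)
        linarith

end Summit.CriticalPhenomena.Ising3D
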